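import Summits.HodgeConjecture.CorCM.MumfordTateRankCMCurvesSurfacesProducts
import Summits.HodgeConjecture.CorCM.MumfordTateRankThreefoldsSharp
import Summits.HodgeConjecture.CorCM.MumfordTateRankTimesRealMultiplicationCells
import Summits.HodgeConjecture.CorCM.MumfordTateRankTimesNonCMCurve
import Summits.HodgeConjecture.CorCM.MumfordTateRankEllipticProducts
import Summits.HodgeConjecture.CorCM.MumfordTateRankSimpleSurfacesSharp
import Literature.AlgebraicGeometry.HodgeTheory.NoTypeIVFactorProducts
import HarnessLib

/-!
# Simple abelian SURFACE × two elliptic CURVES: the Mumford–Tate ranks of the fourfold partition `{2,1,1}` —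
# `t(S × E × E') ∈ {4, …, 15, 17}`, every cell exactly (Moonen–Zarhin 1999 §§2–3, (5.4))

COR-CM (cell `pub-hodgecm2`, seat `b27` gen 49, count-neutral Mumford–Tate-rank ladder; theorems only, no definition, no named fact;
UNCONDITIONAL — nothing here uses or asserts HC_CM).  Notation `t(X) = dim MT(H¹X)`.

For `X ∼ S × (E × E')` with `S` a SIMPLE abelian surface and `E, E'` elliptic curves:
* `S` NOT of CM type (`End⁰S = ℚ`, real quadratic, or indefinite quaternion: `t(S) = 11, 7, 4`): `Hom(E × E', S) = 0`, so
  `t(X) + 1 = t(S) + t(E × E')` (`CorCM/MumfordTateRankTimesRealMultiplicationCells`, Moonen–Zarhin (5.4) «`dim X₂ < 3`») with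
  `t(E × E') ∈ {2, 3, 4, 5, 7}` (`CorCM/MumfordTateRankEllipticProducts`) —
  `mtRank_hodge_one_add_one_eq_add_of_isIsogenous_nonCMSurface_prod_curves`;
* `S` of CM type (`t(S) = 3`): both curves non-CM — `t + 1 = t(E × E') + 3`, `t ∈ {6, 9}`; exactly one CM curve — `X ∼ E' × (S × E)`,
  `t = t(S × E) + 3 = 7`; both CM — `t = 5` (`E ≁ E'`) or `4` (`E ∼ E'`) (`CorCM/MumfordTateRankCMCurvesSurfacesProducts`);
* **`mtRank_hodge_one_mem_of_isIsogenous_simpleSurface_prod_curves`** — altogether `t(X) ∈ {4, 5, 6, 7, 8, 9, 10, 11, 12, 13, 14, 15, 17}`.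

## References
* [MoonenZarhin1999LowDim] B. Moonen, Yu. G. Zarhin, *Hodge classes on abelian varieties of low dimension*, Math. Ann. 315 (1999), §2 (2.2), §3 (3.1),
  Thm. (3.2)(2), Lemma (3.4), §5 (5.4) [corpus: paper:arxiv-math_9901113 pp. 5–7, 10]. [cite: MoonenZarhin1999LowDim, §3 (3.4) and §5 (5.4)]
* [Gordon1999HodgeAVSurvey] B. B. Gordon, *A survey of the Hodge conjecture for abelian varieties*, 7.5–7.7, 9.1. [cite: Gordon1999HodgeAVSurvey, 7.5 and 9.1]
* [MumfordAV1970] D. Mumford, *Abelian Varieties* (1970), §19 Thm. 1, Cor. 1–2. [cite: MumfordAV1970, §19 Cor. 2 of Thm. 1]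
-/

noncomputable section

open CategoryTheory CategoryTheory.Limits Module

namespace Summit.HodgeConjecture.CorCM

open Literature.AlgebraicGeometry.Motives
open Literature.AlgebraicGeometry.Motives.AbelianVariety
open Literature.AlgebraicGeometry.Motives.HodgeStructure
open Literature.AlgebraicGeometry.HodgeTheory
open Literature.AlgebraicGeometry.Milne1999 (IsOfCMType isOfCMType_iff_of_isIsogenous hom_eq_zero_of_isSimple_of_not_isIsogenous)

variable [HodgeTensorFacts.{0, 0}] {X : AbelianVariety ℂ} {n : ℕ}

/-! ## §0 Plumbing -/

omit [HodgeTensorFacts.{0, 0}] in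
/-- `Hom(A × B, C) = 0` when `Hom(A, C) = 0 = Hom(B, C)` (`𝟙_{A×B} = p₁ i₁ + p₂ i₂`). [cite: MumfordAV1970, §19 Thm. 1] -/
theorem forall_hom_prod_eq_zero {A B C : AbelianVariety ℂ} (hA : ∀ v : A ⟶ C, v = 0) (hB : ∀ w : B ⟶ C, w = 0) :
    ∀ u : A.prod B ⟶ C, u = 0 := fun u => by
  have hsumP : fst A B ≫ prodLift (𝟙 A) (0 : A ⟶ B) + snd A B ≫ prodLift (0 : B ⟶ A) (𝟙 B) = 𝟙 _ := by
    refine prod_hom_ext ?_ ?_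
    · rw [Preadditive.add_comp, Category.assoc, Category.assoc, prodLift_fst, prodLift_fst, Category.comp_id,
        comp_zero, add_zero, Category.id_comp]
    · rw [Preadditive.add_comp, Category.assoc, Category.assoc, prodLift_snd, prodLift_snd, Category.comp_id,
        comp_zero, zero_add, Category.id_comp]
  rw [← Category.id_comp u, ← hsumP, Preadditive.add_comp, Category.assoc, Category.assoc, hA (prodLift (𝟙 A) 0 ≫ u),
    hB (prodLift 0 (𝟙 B) ≫ u), comp_zero, comp_zero, add_zero]

omit [HodgeTensorFacts.{0, 0}] in
/-- `Hom(E, S) = 0` for an elliptic curve `E` and a simple abelian surface `S` (simple, non-isogenous: different dimensions).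
[cite: MumfordAV1970, §19 Cor. 2 of Thm. 1] -/
theorem forall_hom_curve_simpleSurface_eq_zero {E S : AbelianVariety ℂ} (hE1 : E.dim = 1) (hSs : S.IsSimple) (hS2 : S.dim = 2) :
    ∀ v : E ⟶ S, v = 0 := fun v =>
  hom_eq_zero_of_isSimple_of_not_isIsogenous (isSimple_of_dim_le_one hE1.le) hSs
    (fun h => by have hd : E.dim = S.dim := dim_eq_of_isIsogenous_holds h; omega) v

/-! ## §1 A simple NON-CM surface: `t(X) + 1 = t(S) + t(E × E')` -/

/-- **`t(S × E × E') + 1 = t(S) + t(E × E')` for `S` a simple abelian surface NOT of CM type** and any elliptic curves `E, E'`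
(`Hom(E × E', S) = 0`; Moonen–Zarhin (5.4)). [cite: MoonenZarhin1999LowDim, §3 (3.4) and §5 (5.4)] [cite: MumfordAV1970, §19 Cor. 2 of Thm. 1] -/
theorem mtRank_hodge_one_add_one_eq_add_of_isIsogenous_nonCMSurface_prod_curves (hX : IsSmoothProjective n X.X) {S E E' : AbelianVariety ℂ}
    (hSs : S.IsSimple) (hS2 : S.dim = 2) (hScm : ¬ IsOfCMType S) (hE1 : E.dim = 1) (hE'1 : E'.dim = 1) (hXP : IsIsogenous X (S.prod (E.prod E'))) :
    haveI := BettiUniverse.finite hX 1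
    haveI := BettiUniverse.finite (AbelianVariety.isSmoothProjective_holds (A := S)) 1
    haveI := BettiUniverse.finite (AbelianVariety.isSmoothProjective_holds (A := E.prod E')) 1
    (BettiUniverse.hodge exists_isReal_hodgeModel_holds hX 1).mtRank + 1 =
      (BettiUniverse.hodge exists_isReal_hodgeModel_holds (AbelianVariety.isSmoothProjective_holds (A := S)) 1).mtRank +
        (BettiUniverse.hodge exists_isReal_hodgeModel_holds (AbelianVariety.isSmoothProjective_holds (A := E.prod E')) 1).mtRank := by
  have h := mtRank_hodge_one_add_one_eq_add_of_isIsogenous_prod_simpleSurface_of_not_isOfCMType hX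
    (AbelianVariety.isSmoothProjective_holds (A := E.prod E')) (AbelianVariety.isSmoothProjective_holds (A := S)) (by rw [dim_prod]; omega)
    hSs hS2 hScm (forall_hom_prod_eq_zero (forall_hom_curve_simpleSurface_eq_zero hE1 hSs hS2) (forall_hom_curve_simpleSurface_eq_zero hE'1 hSs hS2))
    (hXP.trans (Literature.AlgebraicGeometry.HodgeTheory.isIsogenous_prod_comm S (E.prod E')))
  omega

/-- **Simple NON-CM surface × two curves: `t(X) = t(S) + t(E × E') − 1` with `t(S) ∈ {4, 7, 11}` and `t(E × E') ∈ {2, 3, 4, 5, 7}`**, so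
`t(X) ∈ {5, …, 15, 17}`. [cite: MoonenZarhin1999LowDim, §2 (2.2), §3 (3.4) and §5 (5.4)] -/
theorem mtRank_hodge_one_mem_of_isIsogenous_nonCMSurface_prod_curves (hX : IsSmoothProjective n X.X) {S E E' : AbelianVariety ℂ}
    (hSs : S.IsSimple) (hS2 : S.dim = 2) (hScm : ¬ IsOfCMType S) (hE1 : E.dim = 1) (hE'1 : E'.dim = 1) (hXP : IsIsogenous X (S.prod (E.prod E'))) :
    haveI := BettiUniverse.finite hX 1
    (BettiUniverse.hodge exists_isReal_hodgeModel_holds hX 1).mtRank ∈ ({5, 6, 7, 8, 9, 10, 11, 12, 13, 14, 15, 17} : Finset ℕ) := by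
  have hS := AbelianVariety.isSmoothProjective_holds (A := S)
  have hP := AbelianVariety.isSmoothProjective_holds (A := E.prod E')
  haveI := BettiUniverse.finite hX 1
  haveI := BettiUniverse.finite hS 1
  haveI := BettiUniverse.finite hP 1
  have h := mtRank_hodge_one_add_one_eq_add_of_isIsogenous_nonCMSurface_prod_curves hX hSs hS2 hScm hE1 hE'1 hXP
  have hPm := mtRank_hodge_one_of_isIsogenous_prod_curves hP hE1 hE'1 (IsIsogenous.refl _)
  simp only [Finset.mem_insert, Finset.mem_singleton]
  rcases mtRank_hodge_one_of_isSimple_surface_sharp hS hSs hS2 with ⟨-, hS11⟩ | ⟨-, hS7⟩ | ⟨-, -, hcm, -⟩ | ⟨-, -, hS4⟩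
  · rcases hPm with ⟨-, -, -, h2⟩ | ⟨-, -, -, h3⟩ | ⟨-, -, -, h4⟩ | ⟨-, h5⟩ | ⟨-, -, -, h7⟩ <;> omega
  · rcases hPm with ⟨-, -, -, h2⟩ | ⟨-, -, -, h3⟩ | ⟨-, -, -, h4⟩ | ⟨-, h5⟩ | ⟨-, -, -, h7⟩ <;> omega
  · exact absurd hcm hScm
  · rcases hPm with ⟨-, -, -, h2⟩ | ⟨-, -, -, h3⟩ | ⟨-, -, -, h4⟩ | ⟨-, h5⟩ | ⟨-, -, -, h7⟩ <;> omega

/-! ## §2 A simple CM surface -/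

/-- **Simple CM surface × two NON-CM curves: `t(X) + 1 = t(E × E') + 3`, so `t(X) = 6` (`E ∼ E'`) or `9` (`E ≁ E'`)** (`E × E'` has no factor of
type IV, `S` is of CM type: Moonen–Zarhin Thm. (3.2)(2)). [cite: MoonenZarhin1999LowDim, §3 Thm. (3.2)(2) and (3.4)] -/
theorem mtRank_hodge_one_of_isIsogenous_cmSurface_prod_nonCMCurves (hX : IsSmoothProjective n X.X) {S E E' : AbelianVariety ℂ}
    (hSs : S.IsSimple) (hS2 : S.dim = 2) (hScm : IsOfCMType S) (hE1 : E.dim = 1) (hEcm : ¬ IsOfCMType E) (hE'1 : E'.dim = 1)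
    (hE'cm : ¬ IsOfCMType E') (hXP : IsIsogenous X (S.prod (E.prod E'))) :
    haveI := BettiUniverse.finite hX 1
    (IsIsogenous E E' ∧ (BettiUniverse.hodge exists_isReal_hodgeModel_holds hX 1).mtRank = 6) ∨
      (¬ IsIsogenous E E' ∧ (BettiUniverse.hodge exists_isReal_hodgeModel_holds hX 1).mtRank = 9) := by
  have hS := AbelianVariety.isSmoothProjective_holds (A := S)
  have hP := AbelianVariety.isSmoothProjective_holds (A := E.prod E')
  haveI := BettiUniverse.finite hX 1
  haveI := BettiUniverse.finite hS 1
  haveI := BettiUniverse.finite hP 1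
  have hP4 : HasNoTypeIVFactor (E.prod E') := (curve_facts_of_not_isOfCMType hE1 hEcm).2.2.1.prod (curve_facts_of_not_isOfCMType hE'1 hE'cm).2.2.1
  have h3 := (isOfCMType_iff_mtRank_hodge_one_eq_three_of_isSimple_surface hS hSs hS2).1 hScm
  have h := mtRank_hodge_one_add_one_eq_add_of_isIsogenous_prod hX hP hS (by rw [dim_prod]; omega) (by omega) hP4 hScm
    (hXP.trans (Literature.AlgebraicGeometry.HodgeTheory.isIsogenous_prod_comm S (E.prod E')))
  rcases mtRank_hodge_one_of_isIsogenous_prod_curves hP hE1 hE'1 (IsIsogenous.refl _) with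
    ⟨h₁, -, -, -⟩ | ⟨h₁, -, -, -⟩ | ⟨-, -, hiso, h4⟩ | ⟨hne, -⟩ | ⟨-, -, hniso, h7⟩
  · exact absurd h₁ hEcm
  · exact absurd h₁ hEcm
  · exact Or.inl ⟨hiso, by omega⟩
  · exact absurd (iff_of_false hEcm hE'cm) hne
  · exact Or.inr ⟨hniso, by omega⟩

/-- **Simple CM surface × CM curve × NON-CM curve: `t(X) = 7`** (`X ∼ E' × (S × E)`, `Hom(S × E, E') = 0`, `t = t(S × E) + 3 = 4 + 3`).
[cite: MoonenZarhin1999LowDim, §3 (3.1) and Lemma (3.4)] -/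
theorem mtRank_hodge_one_eq_seven_of_isIsogenous_cmSurface_prod_cmCurve_prod_nonCMCurve (hX : IsSmoothProjective n X.X)
    {S E E' : AbelianVariety ℂ} (hSs : S.IsSimple) (hS2 : S.dim = 2) (hScm : IsOfCMType S) (hE1 : E.dim = 1) (hEcm : IsOfCMType E)
    (hE'1 : E'.dim = 1) (hE'cm : ¬ IsOfCMType E') (hXP : IsIsogenous X (S.prod (E.prod E'))) :
    haveI := BettiUniverse.finite hX 1
    (BettiUniverse.hodge exists_isReal_hodgeModel_holds hX 1).mtRank = 7 := by
  have hA := AbelianVariety.isSmoothProjective_holds (A := S.prod E)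
  haveI := BettiUniverse.finite hX 1
  haveI := BettiUniverse.finite hA 1
  -- `X ∼ S × (E × E') ∼ (S × E) × E' ∼ E' × (S × E)`
  have hXP' : IsIsogenous X (E'.prod (S.prod E)) :=
    (hXP.trans (Literature.AlgebraicGeometry.HodgeTheory.isIsogenous_prod_assoc S E E').symm').trans
      (Literature.AlgebraicGeometry.HodgeTheory.isIsogenous_prod_comm (S.prod E) E')
  have hAE : ∀ u : S.prod E ⟶ E', u = 0 :=
    forall_hom_prod_eq_zero
      (fun v => hom_eq_zero_of_isSimple_of_not_isIsogenous hSs (isSimple_of_dim_le_one hE'1.le)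
        (fun h => by have hd : S.dim = E'.dim := dim_eq_of_isIsogenous_holds h; omega) v)
      (fun w => hom_eq_zero_of_isSimple_of_not_isIsogenous (isSimple_of_dim_le_one hE1.le) (isSimple_of_dim_le_one hE'1.le)
        (fun h => hE'cm ((isOfCMType_iff_of_isIsogenous h).1 hEcm)) w)
  have h := mtRank_hodge_one_eq_add_three_of_isIsogenous_nonCMCurve_prod hX hA (by rw [dim_prod]; omega) hE'1 hE'cm hAE hXP'
  have h4 := mtRank_hodge_one_eq_four_of_isIsogenous_cmCurve_prod_cmSurface hA hE1 hEcm hSs hS2 hScm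
    (Literature.AlgebraicGeometry.HodgeTheory.isIsogenous_prod_comm S E)
  omega

/-- **Simple CM surface × two curves: `t(X) ∈ {4, 5, 6, 7, 9}`** (both curves CM: `4`/`5`; one CM: `7`; none: `6`/`9`).
[cite: MoonenZarhin1999LowDim, §3 (3.1), Thm. (3.2)(2) and (3.4)] -/
theorem mtRank_hodge_one_mem_of_isIsogenous_cmSurface_prod_curves (hX : IsSmoothProjective n X.X) {S E E' : AbelianVariety ℂ}
    (hSs : S.IsSimple) (hS2 : S.dim = 2) (hScm : IsOfCMType S) (hE1 : E.dim = 1) (hE'1 : E'.dim = 1) (hXP : IsIsogenous X (S.prod (E.prod E'))) :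
    haveI := BettiUniverse.finite hX 1
    (BettiUniverse.hodge exists_isReal_hodgeModel_holds hX 1).mtRank ∈ ({4, 5, 6, 7, 9} : Finset ℕ) := by
  haveI := BettiUniverse.finite hX 1
  simp only [Finset.mem_insert, Finset.mem_singleton]
  by_cases hEcm : IsOfCMType E <;> by_cases hE'cm : IsOfCMType E'
  · by_cases hEE' : IsIsogenous E E'
    · have h := (mtRank_hodge_one_eq_four_of_isIsogenous_cmSurface_prod_prod_cmCurves_of_isIsogenous hX hSs hS2 hScm hE1 hEcm hEE' hXP).1
      omega
    · have h := (mtRank_hodge_one_eq_five_of_isIsogenous_cmSurface_prod_prod_cmCurves hX hSs hS2 hScm hE1 hEcm hE'1 hE'cm hEE' hXP).1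
      omega
  · have h := mtRank_hodge_one_eq_seven_of_isIsogenous_cmSurface_prod_cmCurve_prod_nonCMCurve hX hSs hS2 hScm hE1 hEcm hE'1 hE'cm hXP
    omega
  · -- swap the curves: `S × (E × E') ∼ S × (E' × E)`
    obtain ⟨g, hg⟩ := Literature.AlgebraicGeometry.HodgeTheory.isIsogenous_prod_comm E E'
    have hXP' : IsIsogenous X (S.prod (E'.prod E)) := hXP.trans ⟨prodMap (𝟙 S) g, isIsogeny_prodMap (isIsogeny_id _) hg⟩
    have h := mtRank_hodge_one_eq_seven_of_isIsogenous_cmSurface_prod_cmCurve_prod_nonCMCurve hX hSs hS2 hScm hE'1 hE'cm hE1 hEcm hXP'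
    omega
  · rcases mtRank_hodge_one_of_isIsogenous_cmSurface_prod_nonCMCurves hX hSs hS2 hScm hE1 hEcm hE'1 hE'cm hXP with ⟨-, h⟩ | ⟨-, h⟩ <;> omega

/-! ## §3 The partition `{2,1,1}` assembled -/

/-- **THE FOURFOLD PARTITION `{2,1,1}`: for `X ∼ S × E × E'` with `S` a simple abelian surface and `E, E'` elliptic curves,
`t(X) ∈ {4, 5, 6, 7, 8, 9, 10, 11, 12, 13, 14, 15, 17}`** — each value attained in the rows above (`S` CM: `4, 5, 6, 7, 9`; QM: `5, 6, 7, 8, 10`;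
RM: `8, 9, 10, 11, 13`; `End⁰S = ℚ`: `12, 13, 14, 15, 17`). [cite: MoonenZarhin1999LowDim, §2 (2.2), §3 and §5 (5.4)] -/
theorem mtRank_hodge_one_mem_of_isIsogenous_simpleSurface_prod_curves (hX : IsSmoothProjective n X.X) {S E E' : AbelianVariety ℂ}
    (hSs : S.IsSimple) (hS2 : S.dim = 2) (hE1 : E.dim = 1) (hE'1 : E'.dim = 1) (hXP : IsIsogenous X (S.prod (E.prod E'))) :
    haveI := BettiUniverse.finite hX 1
    (BettiUniverse.hodge exists_isReal_hodgeModel_holds hX 1).mtRank ∈ ({4, 5, 6, 7, 8, 9, 10, 11, 12, 13, 14, 15, 17} : Finset ℕ) := by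
  haveI := BettiUniverse.finite hX 1
  by_cases hScm : IsOfCMType S
  · have h := mtRank_hodge_one_mem_of_isIsogenous_cmSurface_prod_curves hX hSs hS2 hScm hE1 hE'1 hXP
    simp only [Finset.mem_insert, Finset.mem_singleton] at h ⊢
    omega
  · have h := mtRank_hodge_one_mem_of_isIsogenous_nonCMSurface_prod_curves hX hSs hS2 hScm hE1 hE'1 hXP
    simp only [Finset.mem_insert, Finset.mem_singleton] at h ⊢
    omega

end Summit.HodgeConjecture.CorCM

end
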